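import Mathlib
import HarnessLib
import Summits.NavierStokesRegularity.NavierStokesRegularity.Theses.LocalPlaneStrainDoor
import Summits.NavierStokesRegularity.NavierStokesRegularity.Theorems.PlaneStrainDoorTargets

/-!
# Route `LocalPlaneStrainDoor` (nsreg-p1 ROUND-15 door S16′ «plane-strain window») — birth closer: profile crux `PlaneStrainProfileRigidity`

Moot-by-proof closer (nsreg-p6 g8 S16-family birth kit, DIRECTOR-NS g7 #22): the item text is closed BY NAME against the
landed theorems of `Theorems/PlaneStrainDoor*` (index HOME/ns-regularity-ideate-p6/KIT-INDEX-g8.md §C); statements are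
nsreg-p1's r15/Sketch16 / `route-s16-family/bc/FamilyItems.lean` texts.  WHAT THIS IS NOT: not NS regularity — a
CONDITIONAL one-window door under LOCAL SPACE–TIME Type I.
-/

noncomputable section

-- the summit and its single sub-problem share the name (CONVENTIONS §1)
set_option linter.dupNamespace false

open MeasureTheory Set Function Filter Topology Metric
open scoped RealInnerProductSpace InnerProductSpace NNReal ENNReal
open Literature.Analysis Literature.Analysis.FluidPDE
open Summit.NavierStokesRegularity.NavierStokesRegularity.Theorems.LocalSineTubeDoorLocalPointZoomGradSlices
open Summit.NavierStokesRegularity.NavierStokesRegularity.Theorems.LocalSineTubeDoorWindowFatou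
open Summit.NavierStokesRegularity.NavierStokesRegularity.Theorems.PlaneStrainDoorZoomSpaceTimeDecay
open Summit.NavierStokesRegularity.NavierStokesRegularity.Theorems.PlaneStrainDoorProfileWindowToSlab
open Summit.NavierStokesRegularity.NavierStokesRegularity.Theorems.PlaneStrainDoorProfileLiouvilles
open Summit.NavierStokesRegularity.NavierStokesRegularity.Theorems.PlaneStrainDoorTargets

namespace Summit.NavierStokesRegularity.NavierStokesRegularity.Theorems.LocalPlaneStrainDoorK2Close

/-- **`PlaneStrainProfileRigidity` holds** — it is the landed theorem `PlaneStrainDoorProfileWindowToSlab.planeStrainProfileRigidity` verbatim. -/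
theorem k2_proof : Summit.NavierStokesRegularity.NavierStokesRegularity.Theses.LocalPlaneStrainDoor.PlaneStrainProfileRigidity :=
  Summit.NavierStokesRegularity.NavierStokesRegularity.Theorems.PlaneStrainDoorProfileWindowToSlab.planeStrainProfileRigidity

end Summit.NavierStokesRegularity.NavierStokesRegularity.Theorems.LocalPlaneStrainDoorK2Close

end
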